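import Summits.CriticalPhenomena.PercolationContinuityZ3.Theorems.Transplant.GrigorchukLamplighterCriticalContinuity
import Summits.CriticalPhenomena.PercolationContinuityZ3.Theorems.Transplant.CayleyVirtualRankTwoSomeGens
import HarnessLib

/-!
# `ℤ ≀_X 𝔊`: EVERY finite generating set can be completed to one whose Cayley graph has `p_c < 1` and `θ(p_c) = 0` — the typed instance of
# «CayleyVirtualRankTwoSomeGens» for Bartholdi–Erschler's group over the first Grigorchuk group (`b₁ = 1`, intermediate growth CITED, not typed)

builds on p205010 (kernel theorem, internal audit signed; external expert review pending): through `CayleyVirtualRank.exists_gens_conj4` (p583110) and hence the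
(N3-a) orbit theorem.  Lane `prim-bschramm`, seat `prim-bschramm-p3` gen 34 (design owner; `P3-NILPOTENT.md` §27).  Helper file (`--supports stmt-CriticalPhenomena-4575
--as helper`); PROOFS ONLY (def-free) over «GrigorchukLamplighterDefs» (p581401) and «GrigorchukLamplighterCriticalContinuity» (p582067).  No `@[conjecture]` is declared,
edited or claimed; nothing about the end-state node.

* `Grigorchuk.stabOneW_index : stabOneW.index = 2` — `(⊕ ℤ) ⋊ St(1)` has index two in `Γ₂ = ℤ ≀_X 𝔊` (first-letter dichotomy: `b·a ∈ St(1)`-part iff `b ∉`).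
* `Grigorchuk.blockChar_rank` — the block character has two independent values (`asa ↦ e₀`, `s ↦ e₁`).
* **`Grigorchuk.wreathZ_exists_gens_conj4 (S₀) (hS₀) : ∃ S ⊇ S₀, closure S = ⊤ ∧ ∀ g, p_c(Cay(ℤ ≀_X 𝔊; S)) < 1 ∧ θ_g(p_c) = 0`** — in particular Bartholdi–Erschler's
  standard generating set `{a, b, c, d, s}` is CONTAINED in a finite generating set with Conjecture 4's conclusion (the explicit one `{a, b, c, d, s, asa}` is
  «GrigorchukLamplighterCriticalContinuity»'s `wreathZ_lampComplete_conj4`); the standard set ITSELF stays not proved (`P3-NILPOTENT.md` §26.7 / §27.3).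
This is also the INHABITEDNESS check of `CayleyVirtualRank.exists_gens_conj4`'s hypotheses by a typed group with `b₁ = 1` (so outside U_s) and — by citation —
intermediate growth (outside Hutchcroft / rung Q / the covering route).
[cite: BenjaminiSchramm1996, Conj. 4; §2 (Cayley graphs)] [cite: BartholdiErschler2012, §2 (standard generating set), §3.1 ([𝔊 : St(1)] = 2), Thm. 5.3]
-/

noncomputable section

namespace Summit.CriticalPhenomena.PercolationContinuityZ3.Theorems.Transplant

open SimpleGraph Literature.Probability.Percolation Literature.Probability.LatticeModels
open scoped Classical

namespace Grigorchuk

/-- **`[Γ₂ : (⊕ ℤ) ⋊ St(1)] = 2`**: by the first-letter dichotomy, `g·a` has first-letter-preserving tree part iff `g` has not.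
[cite: BartholdiErschler2012, §3.1 ([𝔊 : St(1)] = 2)] -/
theorem stabOneW_index : stabOneW.index = 2 := by
  rw [Subgroup.index_eq_two_iff]
  refine ⟨aW, fun g => ?_⟩
  -- the tree part of `g·a` at a ray `x` is `g.right (a x)`, whose first letter is that of `g.right` applied to a ray with FLIPPED first letter
  have key : ∀ x : Ray, ((g * aW : ↥wreathZ) : LampGroup ℤ).right x 0 = (g : LampGroup ℤ).right (genA x) 0 := fun x => by
    change ((g : LampGroup ℤ) * (aW : LampGroup ℤ)).right x 0 = _
    rw [SemidirectProduct.mul_right, coe_aW, tree_right, Equiv.Perm.mul_apply]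
  rcases firstLetter_dichotomy g with h | h
  · -- `g` preserves first letters: `g ∈ stabOneW`, `g·a ∉`
    refine Or.inr ⟨mem_stabOneW.2 h, fun hga => ?_⟩
    have h1 := mem_stabOneW.1 hga rho
    rw [key, h, genA_apply_zero] at h1
    simp [rho] at h1
  · -- `g` flips first letters: `g ∉ stabOneW`, `g·a ∈`
    refine Or.inl ⟨mem_stabOneW.2 fun x => ?_, fun hg => ?_⟩
    · rw [key, h, genA_apply_zero, Bool.not_not]
    · have h1 := mem_stabOneW.1 hg rho
      rw [h] at h1
      simp [rho] at h1

/-- **The block character has rank two**: `c(asa) = e₀`, `c(s) = e₁`, `det = 1`. [folklore] -/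
theorem blockChar_rank : ∃ x y : ↥stabOneW, MaxArea.det2 (Multiplicative.toAdd (blockChar x)) (Multiplicative.toAdd (blockChar y)) ≠ 0 := by
  have hs' : s'W ∈ stabOneW := lamp_mem_stabOneW (by rw [coe_s'W, lamp_right])
  have hs : sW ∈ stabOneW := lamp_mem_stabOneW (by rw [coe_sW, lamp_right])
  refine ⟨⟨s'W, hs'⟩, ⟨sW, hs⟩, ?_⟩
  rw [toAdd_blockChar_of_left_eq ⟨s'W, hs'⟩ (y := genA rho) (m := 1) (by change (lamp (genA rho) (1 : ℤ) : LampGroup ℤ).left = _; rw [lamp_left]),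
    toAdd_blockChar_of_left_eq ⟨sW, hs⟩ (y := rho) (m := 1) (by change (lamp rho (1 : ℤ) : LampGroup ℤ).left = _; rw [lamp_left]),
    genA_rho_zero, rho_zero, MaxArea.det2]
  simp

/-- **THEOREM (KERNEL): every finite generating set `S₀` of `Γ₂ = ℤ ≀_X 𝔊` is contained in a finite generating set `S` with `p_c(Cay(Γ₂; S)) < 1` and
`θ_g(p_c) = 0` at every vertex** — «CayleyVirtualRankTwoSomeGens» instantiated at the index-two subgroup `(⊕ ℤ) ⋊ St(1)` and its block character.
(`Γ₂` has `b₁ = 1` and intermediate growth — CITED, not typed; the standard generating set `{a, b, c, d, s}` itself stays not proved.)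
builds on p205010 (kernel theorem, internal audit signed; external expert review pending).
[cite: BenjaminiSchramm1996, Conj. 4; §2 (Cayley graphs)] [cite: BartholdiErschler2012, §2 (standard generating set), Thm. 5.3] -/
theorem wreathZ_exists_gens_conj4 (S₀ : Finset ↥wreathZ) (hS₀ : Subgroup.closure (↑S₀ : Set ↥wreathZ) = ⊤) :
    ∃ S : Finset ↥wreathZ, S₀ ⊆ S ∧ Subgroup.closure (↑S : Set ↥wreathZ) = ⊤ ∧
      ∀ g : ↥wreathZ, criticalProb (mulCayley (↑S : Set ↥wreathZ)) g < 1 ∧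
        theta (mulCayley (↑S : Set ↥wreathZ)) g (criticalProbIOf (mulCayley (↑S : Set ↥wreathZ)) g) = 0 := by
  haveI : stabOneW.FiniteIndex := Subgroup.finiteIndex_iff.2 (by rw [stabOneW_index]; decide)
  exact CayleyVirtualRank.exists_gens_conj4 stabOneW blockChar blockChar_rank S₀ hS₀

/-- **In particular Bartholdi–Erschler's standard generating set `{a, b, c, d, s}` is contained in a finite generating set whose Cayley graph has `p_c < 1` and
`θ(p_c) = 0`** (the explicit completion `{a, b, c, d, s, asa}` is `wreathZ_lampComplete_conj4`). builds on p205010 (kernel theorem, internal audit signed; external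
expert review pending). [cite: BartholdiErschler2012, §2 (standard generating set)] -/
theorem wreathZ_standardGens_subset_conj4 :
    ∃ S : Finset ↥wreathZ, ({aW, bW, cW, dW, sW} : Finset ↥wreathZ) ⊆ S ∧ Subgroup.closure (↑S : Set ↥wreathZ) = ⊤ ∧
      ∀ g : ↥wreathZ, criticalProb (mulCayley (↑S : Set ↥wreathZ)) g < 1 ∧
        theta (mulCayley (↑S : Set ↥wreathZ)) g (criticalProbIOf (mulCayley (↑S : Set ↥wreathZ)) g) = 0 := by
  refine wreathZ_exists_gens_conj4 _ ?_
  -- `{a, b, c, d, s}` generates `Γ₂` by definition of `wreathZ`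
  have h := Subgroup.closure_closure_coe_preimage
    (k := ({tree genA, tree genB, tree genC, tree genD, lamp rho 1} : Set (LampGroup ℤ)))
  refine eq_top_iff.2 (le_trans (eq_top_iff.1 h) (Subgroup.closure_mono ?_))
  intro π hπ
  have hπ' : (π : LampGroup ℤ) ∈ ({tree genA, tree genB, tree genC, tree genD, lamp rho 1} : Set (LampGroup ℤ)) := hπ
  simp only [Finset.coe_insert, Finset.coe_singleton, Set.mem_insert_iff, Set.mem_singleton_iff] at hπ' ⊢
  rcases hπ' with h | h | h | h | h
  · exact Or.inl (Subtype.ext h)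
  · exact Or.inr (Or.inl (Subtype.ext h))
  · exact Or.inr (Or.inr (Or.inl (Subtype.ext h)))
  · exact Or.inr (Or.inr (Or.inr (Or.inl (Subtype.ext h))))
  · exact Or.inr (Or.inr (Or.inr (Or.inr (Subtype.ext h))))

end Grigorchuk

end Summit.CriticalPhenomena.PercolationContinuityZ3.Theorems.Transplant

end
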